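import Summits.QuantumFields.YangMills.Theorems.BalabanUVNodesK0Gauge152RFluxFloor
import Literature.MathematicalPhysics.QuantumFieldTheory.Balaban1983to89.Node00.TorusCoverGaugeTokensRPrint

/-!
# K0⁷ STUB 2′ (plan V19 `stub_prop6MemberB8AtP13`) — THE FLUX FLOOR OF ITS CONSTANT: `B₁ = 0` REFUTED at every big-block size `ρ₀`, and the
# QUANTITATIVE floor `1 ≤ 2912·L⁵·B₁` (for 2′ AND for V18's stub 2)

Cell `pub-ymgap`, seat `pub-ymgap-k0-s2-w2` g2 (K0⁷ stub-2 width seat 2∕2, director-ym №197 ∕ HUMAN RULING D-0149).  Key K0⁷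
**stmt-QuantumFields-20541** (`Record13SepCoPHInhabited`), `--kind proof --supports stmt-QuantumFields-20541 --as helper`.
[6] = [Balaban1985RegularSpaces] (Prop. 6 p. 99, p. 98); [15] = [Balaban1985Variational] ((144)–(152) pp. 300–301).

THE STUB (plan g80 V19 draft kit; text of record plan g79 l.24860 ∕ dag-n21-c PART 2 `h2P`):
`Prop6MemberB8AtP F := ∃ ρ₀ B₁ c₁, 1 ≤ ρ₀ ∧ 0 ≤ B₁ ∧ 0 < c₁ ∧ B8.Prop6Printed 4 (F.L:ℝ) B₁ c₁ (fun i : ZdIdx 4 F.L => zdCubP (MatA 2) F.L ρ₀ i)`.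

WHAT THIS FILE PROVES (kernel; theorems only, 0 `def`) — FILE D′'s (`K0Gauge152RFluxFloor`, p549913) §2 letters for V18's stub 2, RE-RUN ON PRINT'S CUBE CLASS
through dag-n07-e's bare-block token `Node00.gauge152RP_of_prop6_of_one_le` (36c, p590213):
§1 ★ `L_mul_le_b9OfP_of_prop6MemberP` — the cut member sentence at `ρ₀ ≥ 1` (`0 ≤ B₁`, `0 < c₁`, `N ≥ 2`) forces `F.L·M ≤ 26·b9OfP F M (ρ₀·F.L) B₁` at EVERY
   cube letter `M ≥ 1` (`b9OfP = 112·L⁵·B₁·(LM + 44 + 2ρ₀L) + 1`); ★ `pos_of_prop6MemberP` — hence `0 < B₁` (at `M = 3`, `B₁ = 0` reads `3L ≤ 26`, false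
   since `L ≥ 13`); `not_prop6MemberP_zero` — `B₁ = 0` refuted BY VALUE at every `ρ₀ ≥ 1`.
§2 ★★ `one_le_of_prop6MemberP` — THE QUANTITATIVE FLOOR: the cut member sentence forces `1 ≤ 2912·L⁵·B₁` (`2912 = 26·112`; letting the cube letter
   `M → ∞` in §1: `(1 − 2912L⁵B₁)·L·M ≤ 2912L⁵B₁(44 + 2ρ₀L) + 26` for all `M`); ★★ `one_le_of_prop6Member` — the SAME floor for V18's stub 2 (all cubes,
   FILE 29's `b9Of`); `prop6MemberB8AtPBody_B₁_floor` — in V19's body shape: every witness `(ρ₀, B₁, c₁)` has `(2912·L⁵)⁻¹ ≤ B₁`.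
LOCATED (for the V19 witness numerics ∕ HONEST FRAMING): any constants tuple closing stub 2′ carries `B₁ ≥ (2912·L⁵)⁻¹`; n05-e's flat-line witness
`B₁ = 5dL·B₀ ≥ 2` (`2 ≤ 5dLB₀`) clears it; the floor is print-compatible («positive constants B₁», [6] Prop. 6) and reads nothing of Bałaban's analysis —
it is the (152)-flux floor of the K0 road's token ([15] (152): `ε_nL²·(cube flux)` within the `2π`-window) composed with the 36c bridge.

HONEST FRAMING: bookkeeping + arithmetic about TREE-typed sentences; nothing of Bałaban is asserted, proved or refuted here; stub 2 ∕ 2′ NEITHER proved NOR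
refuted; K0⁷ OPEN; N05 ∕ N07 NOT discharged; V18 3bcb71246bb7298d STANDS until the plan registers V19; counts unmoved (typed 28∕28 · discharged 5∕27); one finite
`𝕋⁴` programme at fixed `ε = L^{−K}`; the YM mass gap (Clay) is NOT proved by any of this — R4 closes the conditional finite-`𝕋⁴` rung `BalabanLadder.UV` only;
nothing continuum ∕ ℝ⁴ ∕ OS.  THEOREMS ONLY: no `def`, `instance`, `notation`, `sorry`; standard axioms; default heartbeats.
-/

noncomputable section

open scoped Matrix.Norms.L2Operator

namespace Summit.QuantumFields.YangMills.Theorems.K0Stub2PrimeFluxFloor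

open Literature.MathematicalPhysics.QuantumFieldTheory.Balaban1983to89
open Literature.MathematicalPhysics.QuantumFieldTheory.Balaban1983to89.Node00
open Literature.MathematicalPhysics.QuantumFieldTheory.Balaban1983to89.T4Continuum
open B8LeafModelZd (ZdIdx)
open Summit.QuantumFields.YangMills.Theorems.K0Gauge152RFluxFloor (L_mul_le_of_gauge152OfClassTopStepR L_mul_le_b9Of_of_prop6Member)

variable {F : T4Family} {N : ℕ} [NeZero N]

/-! ## §1  The flux floor on print's cube class: `B₁ = 0` refuted at every `ρ₀` -/

/-- ★ **THE FLUX FLOOR OF [6] PROP. 6 ON PRINT'S CUBE CLASS** (`ρ₀ ≥ 1`, `0 ≤ B₁`, `0 < c₁`, `N ≥ 2`): the cut member sentence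
`B8.Prop6Printed 4 L B₁ c₁ (zdCubP (MatA N) L ρ₀ ·)` over n05-a's whole index forces `F.L·M ≤ 26·b9OfP F M (ρ₀·F.L) B₁` at EVERY cube letter `M ≥ 1` —
dag-n07-e's 36c token `gauge152RP_of_prop6_of_one_le` (the (152)∕(9) gauge from Prop. 6 on the `ρ₀L`-cubes, `0 < a0OfP`) composed with FILE D′'s clean floor
`L_mul_le_of_gauge152OfClassTopStepR`. [cite: Balaban1985RegularSpaces, Prop. 6 (1.135)–(1.137) p.99, p.98; Balaban1985Variational, (152) p.301] -/
theorem L_mul_le_b9OfP_of_prop6MemberP (hN : 2 ≤ N) {ρ₀ : ℕ} (hρ₀ : 1 ≤ ρ₀) {B₁ c₁ : ℝ} (hB₁ : 0 ≤ B₁) (hc₁ : 0 < c₁)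
    (hP6 : letI : CStarAlgebra (MatA N) := {}; B8.Prop6Printed 4 (F.L : ℝ) B₁ c₁ (fun i : ZdIdx 4 F.L => zdCubP (MatA N) F.L ρ₀ i))
    {M : ℕ} (hM : 1 ≤ M) : (F.L : ℝ) * M ≤ 26 * b9OfP F M (ρ₀ * F.L) B₁ :=
  L_mul_le_of_gauge152OfClassTopStepR hN hM (a0OfP_pos (F := F) (N := N) M (ρ₀ * F.L) hB₁ hc₁) (gauge152RP_of_prop6_of_one_le hB₁ hc₁ hρ₀ hP6 M)

/-- ★ **[6] PROP. 6 ON PRINT'S CUBE CLASS FORCES `0 < B₁`** at every big-block size `ρ₀ ≥ 1` (`0 ≤ B₁`, `0 < c₁`, `N ≥ 2`): at `M = 3` the floor reads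
`3L ≤ 26·(112·L⁵·B₁·(3L + 44 + 2ρ₀L) + 1)`, impossible at `B₁ = 0` since `L ≥ 13`.  V19's stub 2′ therefore has no witness with `B₁ = 0` (print: «positive
constants»; n05-e's road: `B₁ = 5dLB₀ ≥ 2`). [cite: Balaban1985RegularSpaces, Prop. 6 p.99 (bookkeeping floor); Balaban1985Variational, (152) p.301] -/
theorem pos_of_prop6MemberP (hN : 2 ≤ N) {ρ₀ : ℕ} (hρ₀ : 1 ≤ ρ₀) {B₁ c₁ : ℝ} (hB₁ : 0 ≤ B₁) (hc₁ : 0 < c₁)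
    (hP6 : letI : CStarAlgebra (MatA N) := {}; B8.Prop6Printed 4 (F.L : ℝ) B₁ c₁ (fun i : ZdIdx 4 F.L => zdCubP (MatA N) F.L ρ₀ i)) : 0 < B₁ := by
  have h := L_mul_le_b9OfP_of_prop6MemberP hN hρ₀ hB₁ hc₁ hP6 (M := 3) (by norm_num)
  have hL13 : 13 ≤ F.L := by obtain ⟨hodd, _⟩ := F.hL; have := F.hL11; rcases hodd with ⟨r, hr⟩; omega
  have hLR : (13 : ℝ) ≤ F.L := by exact_mod_cast hL13
  by_contra hB
  have hB0 : B₁ = 0 := le_antisymm (not_lt.mp hB) hB₁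
  rw [hB0] at h
  unfold b9OfP at h
  push_cast at h
  nlinarith [h, hLR]

/-- `B₁ = 0` is refuted BY VALUE for the cut member sentence at every `ρ₀ ≥ 1` (`0 < c₁`, `N ≥ 2`). [cite: Balaban1985RegularSpaces, Prop. 6 p.99 (bookkeeping floor)] -/
theorem not_prop6MemberP_zero (hN : 2 ≤ N) {ρ₀ : ℕ} (hρ₀ : 1 ≤ ρ₀) {c₁ : ℝ} (hc₁ : 0 < c₁) :
    ¬ (letI : CStarAlgebra (MatA N) := {}; B8.Prop6Printed 4 (F.L : ℝ) 0 c₁ (fun i : ZdIdx 4 F.L => zdCubP (MatA N) F.L ρ₀ i)) :=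
  fun h => absurd (pos_of_prop6MemberP (F := F) hN hρ₀ le_rfl hc₁ h) (lt_irrefl 0)

/-! ## §2  The quantitative floor `1 ≤ 2912·L⁵·B₁` (for 2′ and for V18's stub 2) -/

/-- **ARITHMETIC OF THE FLOOR**: if `L·M ≤ 26·(112·L⁵·B₁·(L·M + s) + 1)` for EVERY `M ≥ 1` (`L > 0`, `s ≥ 0`, `B₁ ≥ 0`), then `1 ≤ 2912·L⁵·B₁` — otherwise
`(1 − 2912L⁵B₁)·L·M ≤ 2912L⁵B₁·s + 26` bounds `M`. [folklore] -/
theorem one_le_of_forall_floor {L B₁ s : ℝ} (hL : 0 < L) (hB₁ : 0 ≤ B₁) (hs : 0 ≤ s)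
    (h : ∀ M : ℕ, 1 ≤ M → L * M ≤ 26 * (112 * L ^ 5 * B₁ * (L * M + s) + 1)) : 1 ≤ 2912 * L ^ 5 * B₁ := by
  by_contra hX
  rw [not_le] at hX
  have hX0 : 0 ≤ 2912 * L ^ 5 * B₁ := by positivity
  have hδ : 0 < (1 - 2912 * L ^ 5 * B₁) * L := mul_pos (by linarith) hL
  have hC : 0 ≤ 2912 * L ^ 5 * B₁ * s + 26 := by positivity
  obtain ⟨M, hM⟩ := exists_nat_gt ((2912 * L ^ 5 * B₁ * s + 26) / ((1 - 2912 * L ^ 5 * B₁) * L))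
  have hMpos : (0 : ℝ) < M := lt_of_le_of_lt (div_nonneg hC hδ.le) hM
  have hM1 : 1 ≤ M := Nat.cast_pos.mp hMpos
  have hfl := h M hM1
  have key : ((1 - 2912 * L ^ 5 * B₁) * L) * M ≤ 2912 * L ^ 5 * B₁ * s + 26 := by nlinarith [hfl]
  have hle : (M : ℝ) ≤ (2912 * L ^ 5 * B₁ * s + 26) / ((1 - 2912 * L ^ 5 * B₁) * L) := by
    rw [le_div_iff₀ hδ]; linarith [key]
  linarith [hM, hle]

/-- ★★ **THE QUANTITATIVE FLOOR OF STUB 2′'s CONSTANT**: the cut member sentence at `ρ₀ ≥ 1` (`0 ≤ B₁`, `0 < c₁`, `N ≥ 2`) forces `1 ≤ 2912·L⁵·B₁`, i.e.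
`B₁ ≥ (2912·L⁵)⁻¹` (§1 at every `M`, then `M → ∞`). [cite: Balaban1985RegularSpaces, Prop. 6 p.99 (bookkeeping floor); Balaban1985Variational, (152) p.301] -/
theorem one_le_of_prop6MemberP (hN : 2 ≤ N) {ρ₀ : ℕ} (hρ₀ : 1 ≤ ρ₀) {B₁ c₁ : ℝ} (hB₁ : 0 ≤ B₁) (hc₁ : 0 < c₁)
    (hP6 : letI : CStarAlgebra (MatA N) := {}; B8.Prop6Printed 4 (F.L : ℝ) B₁ c₁ (fun i : ZdIdx 4 F.L => zdCubP (MatA N) F.L ρ₀ i)) :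
    1 ≤ 2912 * (F.L : ℝ) ^ 5 * B₁ := by
  have hLpos : (0 : ℝ) < F.L := by exact_mod_cast (F.P 0).L_pos
  refine one_le_of_forall_floor (s := 44 + 2 * (ρ₀ * (F.L : ℝ))) hLpos hB₁ (by positivity) fun M hM => ?_
  have h := L_mul_le_b9OfP_of_prop6MemberP hN hρ₀ hB₁ hc₁ hP6 hM
  unfold b9OfP at h
  push_cast at h
  linarith [h]

/-- ★★ **THE SAME FLOOR FOR V18's STUB 2** (all cubes, `zdCub`; FILE D′'s `L_mul_le_b9Of_of_prop6Member` at every `M`, then `M → ∞`): the member sentence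
`B8.Prop6Printed 4 L B₁ c₁ (zdCub (MatA N) L ·)` (`0 ≤ B₁`, `0 < c₁`, `N ≥ 2`) forces `1 ≤ 2912·L⁵·B₁`. [cite: Balaban1985RegularSpaces, Prop. 6 p.99 (bookkeeping floor); Balaban1985Variational, (152) p.301] -/
theorem one_le_of_prop6Member (hN : 2 ≤ N) {B₁ c₁ : ℝ} (hB₁ : 0 ≤ B₁) (hc₁ : 0 < c₁)
    (hP6 : letI : CStarAlgebra (MatA N) := {}; B8.Prop6Printed 4 (F.L : ℝ) B₁ c₁ (fun i : ZdIdx 4 F.L => zdCub (MatA N) F.L i)) :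
    1 ≤ 2912 * (F.L : ℝ) ^ 5 * B₁ := by
  have hLpos : (0 : ℝ) < F.L := by exact_mod_cast (F.P 0).L_pos
  refine one_le_of_forall_floor (s := 44 + (F.L : ℝ)) hLpos hB₁ (by positivity) fun M hM => ?_
  have h := L_mul_le_b9Of_of_prop6Member hN hB₁ hc₁ hP6 hM
  unfold b9Of at h
  push_cast at h
  linarith [h]

/-- **IN V19's BODY SHAPE** (`N = 2`, spelled verbatim): every witness `(ρ₀, B₁, c₁)` of `Prop6MemberB8AtP F` has `(2912·L⁵)⁻¹ ≤ B₁` — the located floor any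
closing numerics must carry. [cite: Balaban1985RegularSpaces, Prop. 6 p.99 (bookkeeping floor)] -/
theorem prop6MemberB8AtPBody_B₁_floor {ρ₀ : ℕ} {B₁ c₁ : ℝ}
    (h : 1 ≤ ρ₀ ∧ 0 ≤ B₁ ∧ 0 < c₁ ∧
      (letI : CStarAlgebra (MatA 2) := {}; B8.Prop6Printed 4 (F.L : ℝ) B₁ c₁ (fun i : ZdIdx 4 F.L => zdCubP (MatA 2) F.L ρ₀ i))) :
    (2912 * (F.L : ℝ) ^ 5)⁻¹ ≤ B₁ := by
  obtain ⟨hρ₀, hB₁, hc₁, hP6⟩ := h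
  have hLpos : (0 : ℝ) < F.L := by exact_mod_cast (F.P 0).L_pos
  have hK : (0 : ℝ) < 2912 * (F.L : ℝ) ^ 5 := by positivity
  have h1 := one_le_of_prop6MemberP (F := F) (N := 2) (by norm_num) hρ₀ hB₁ hc₁ hP6
  rw [inv_le_iff_one_le_mul₀ hK]
  linarith [h1]

end Summit.QuantumFields.YangMills.Theorems.K0Stub2PrimeFluxFloor

end
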